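import Summits.BirchSwinnertonDyer.Rank1Residual.ManinAdditive.DegeneracyLoopLaws

/-!
# The `q`-tower differences lie in `Λ₁(f)` from level `2` on — the EASY HALF of E-an-138 / E-an-137 (MEMO-an §71.5; STRUCTURAL
# LEMMA of §71.1: all cusps `b/qⁿ`, `q ∤ b`, are `Γ₁(N)`-equivalent when `q ∤ N`)

Summit `BirchSwinnertonDyer`, route `ManinLocalTwoThree` (cell bsd-f2-manin, analytic lens g29), cruxes C3 `ManinPrimeToThreeAtNine`
(stmt-BirchSwinnertonDyer-22968) / C2 `ManinOddAtFour` (stmt-…-22967).  The laws E-an-137 `UnipotentTowerGeneration p q N` / E-an-138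
`EventualLevelGeneration q N` (HOME/an/g29/Sketch-an-g29.lean §4) compare `Λ₁(f) = periodLatticeGamma1 f` with the subgroup generated by the
LEVEL-`n` DIFFERENCES `{∞, (b + t q^{n-1})/qⁿ}_f − {∞, b/qⁿ}_f`, `q ∤ b`, `t ∈ ℤ`.  This file proves the containment that needs no law:

* `levelDifference_mem_periodLatticeGamma1` — for a prime `q ∤ N` and `n ≥ 2`, every level-`n` difference lies in `Λ₁(f)` (both cusps have
  denominator exactly `qⁿ`, prime to `N`: tree `modularSymbol_sub_mem_periodLatticeGamma1`).
* `closure_levelDifferences_le_periodLatticeGamma1`, `closure_towerDifferences_le_periodLatticeGamma1` — hence the closures (the Sketch's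
  `AddSubgroup.closure (levelDifferences f q n)`, `… (towerDifferences f q n₁)`, by value) are `≤ Λ₁(f)` for `n ≥ 2` / `n₁ ≥ 2`.

CAVEAT (why `n ≥ 2`): at `n = 1` the Sketch's `levelDifferences f q 1` also contains `{∞, (b+t)/q} − {∞, b/q}` with `q ∣ b + t`, i.e.
`{∞, 0} − {∞, b/q}`, which is a `Γ₀(N)`- but in general NOT a `Γ₁(N)`-period; so E-an-138's `∃ n₂` should be read with `n₂ ≥ 2` and E-an-137
instantiated from level `2` on (as in `…Theorems.ManinLocalTwoThreeTowerUnitTwist`).  HONEST FRAMING: bookkeeping; the generation laws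
themselves (the reverse containments up to prime-to-`p` index) remain OPEN.  Nothing about Manin's conjecture or BSD is asserted.  No
definitions, no sorry.
-/

set_option linter.dupNamespace false
set_option autoImplicit false

noncomputable section

open scoped Classical MatrixGroups ModularForm

open CongruenceSubgroup Literature.NumberTheory.EllipticCurves Literature.NumberTheory.EllipticCurves.ModularForms
  Summit.BirchSwinnertonDyer.Rank1Residual.ManinAdditive.Gamma1Lattice

namespace Summit.BirchSwinnertonDyer.BirchSwinnertonDyer.Theorems.ManinLocalTwoThree

variable {N : ℕ} [NeZero N] (f : CuspForm (Gamma0 N) 2)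

/-- **Level-`n` tower differences are `Γ₁(N)`-periods** (`n ≥ 2`, `q` prime, `q ∤ N`, `q ∤ b`): the cusps `b/qⁿ` and `(b + t q^{n-1})/qⁿ`
both have exact denominator `qⁿ`, prime to `N`, so they are `Γ₁(N)`-equivalent. [folklore] -/
theorem levelDifference_mem_periodLatticeGamma1 {q : ℕ} (hq : q.Prime) (hqN : ¬ q ∣ N) {n : ℕ} (hn : 2 ≤ n)
    {b : ℤ} (hb : ¬ (q : ℤ) ∣ b) (t : ℤ) :
    modularSymbol f (((b + t * (q : ℤ) ^ (n - 1) : ℤ) : ℚ) / (q : ℚ) ^ n) - modularSymbol f ((b : ℚ) / (q : ℚ) ^ n)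
      ∈ periodLatticeGamma1 f := by
  have hqZ : IsCoprime (q : ℤ) b := by
    rw [Int.isCoprime_iff_gcd_eq_one]
    exact (Nat.Prime.coprime_iff_not_dvd hq).mpr fun h ↦ hb (Int.natCast_dvd.mpr h)
  have hm : ((q : ℤ) ^ n) ≠ 0 := pow_ne_zero _ (by exact_mod_cast hq.ne_zero)
  have hbcop : IsCoprime b ((q : ℤ) ^ n) := hqZ.symm.pow_right
  obtain ⟨k, hk⟩ : ∃ k, n - 1 = k + 1 := ⟨n - 2, by omega⟩
  have hb'cop : IsCoprime (b + t * (q : ℤ) ^ (n - 1)) ((q : ℤ) ^ n) := by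
    have e : b + t * (q : ℤ) ^ (n - 1) = b + (q : ℤ) * (t * (q : ℤ) ^ k) := by rw [hk, pow_succ]; ring
    rw [e]
    exact (hqZ.add_mul_left_right (t * (q : ℤ) ^ k)).symm.pow_right
  have hNq : IsCoprime (N : ℤ) ((q : ℤ) ^ n) :=
    IsCoprime.pow_right (Nat.isCoprime_iff_coprime.mpr
      (Nat.coprime_comm.mp ((Nat.Prime.coprime_iff_not_dvd hq).mpr hqN)))
  have h := modularSymbol_sub_mem_periodLatticeGamma1 f hm hb'cop hbcop hNq
  have e : (((q : ℤ) ^ n : ℤ) : ℚ) = (q : ℚ) ^ n := by push_cast; ring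
  rwa [e] at h

/-- The subgroup generated by the level-`n` differences (`n ≥ 2`) is contained in `Λ₁(f)` — the easy half of E-an-138
`EventualLevelGeneration q N` (Sketch-an-g29 §4, `levelDifferences` by value). -/
theorem closure_levelDifferences_le_periodLatticeGamma1 {q : ℕ} (hq : q.Prime) (hqN : ¬ q ∣ N) {n : ℕ} (hn : 2 ≤ n) :
    AddSubgroup.closure {z : ℂ | ∃ b t : ℤ, ¬ (q : ℤ) ∣ b ∧
        z = modularSymbol f (((b + t * (q : ℤ) ^ (n - 1) : ℤ) : ℚ) / (q : ℚ) ^ n) -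
            modularSymbol f ((b : ℚ) / (q : ℚ) ^ n)} ≤ periodLatticeGamma1 f := by
  refine (AddSubgroup.closure_le _).mpr ?_
  rintro z ⟨b, t, hb, rfl⟩
  exact levelDifference_mem_periodLatticeGamma1 f hq hqN hn hb t

/-- The subgroup generated by ALL tower differences of level `≥ n₁`, `n₁ ≥ 2`, is contained in `Λ₁(f)` — the easy half of E-an-137
`UnipotentTowerGeneration p q N` (Sketch-an-g29 §4, `towerDifferences` by value). -/
theorem closure_towerDifferences_le_periodLatticeGamma1 {q : ℕ} (hq : q.Prime) (hqN : ¬ q ∣ N) {n₁ : ℕ} (hn₁ : 2 ≤ n₁) :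
    AddSubgroup.closure (⋃ (n : ℕ) (_ : n₁ ≤ n) (_ : 1 ≤ n), {z : ℂ | ∃ b t : ℤ, ¬ (q : ℤ) ∣ b ∧
        z = modularSymbol f (((b + t * (q : ℤ) ^ (n - 1) : ℤ) : ℚ) / (q : ℚ) ^ n) -
            modularSymbol f ((b : ℚ) / (q : ℚ) ^ n)}) ≤ periodLatticeGamma1 f := by
  refine (AddSubgroup.closure_le _).mpr ?_
  intro z hz
  simp only [Set.mem_iUnion, Set.mem_setOf_eq] at hz
  obtain ⟨n, hn, -, b, t, hb, rfl⟩ := hz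
  exact levelDifference_mem_periodLatticeGamma1 f hq hqN (le_trans hn₁ hn) hb t

end Summit.BirchSwinnertonDyer.BirchSwinnertonDyer.Theorems.ManinLocalTwoThree

end
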